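import Mathlib
import Summits.KontsevichZagierPeriods.Zeta5Search.WedgeDictionaryKernelCellsBridge
import Summits.KontsevichZagierPeriods.Zeta5Search.InvarianceGroup
import Summits.KontsevichZagierPeriods.Zeta5Search.BarnesDouble
import Summits.KontsevichZagierPeriods.Zeta5Search.CellularCubicalSubstitution
import HarnessLib

/-!
# The cellular BRIDGE family is a KERNEL THEOREM: `CellBridge` holds (cell `pub-zeta5`, seat ct-1 g18)

HONEST FRAMING: systematic search; no irrationality claim unless certified.  Identities among Brown–Zudilin's absolutely
convergent cellular integrals `I(a)` (arXiv:2210.03391, Sect. 1 (1), Sect. 3 (8)/(10), Sect. 5 (16)); no integral is evaluated,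
no linear form is bounded, nothing about ζ(5), no `γ`, no denominator statement.

OUR work (Summit side).  The `@[conjecture]` node `WedgeDictionary.CellBridge` (`WedgeDictionaryBridge.lean`, gen-1 g15) is the
mixed-parity four-term relation `d_c·I(a) + d₇·I(a − s₇) + d_X·I(a + e₁ + e₃) + d_DS·I(a + DS) = 0` among the cellular integrals at
the BRIDGE cluster, asserted at every parameter `a` whose four members satisfy the hypotheses of `explicitPQ` (`RegionHyp`).  gen-1
g22's NATIVE certificate `KernelCells.cellBridge_native` proves it from F1 (`cellularIntegral_eq_cubicalIntegral`,
`cubicalIntegral_eq_Jintegral`) and F2 (`barnes_double`) — all three tree theorems now — but ONLY where the four members share a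
rational chamber point of the double Barnes integral (16); at levels `≤ 8` that fails at `44 %` of the sites (ct-1 g17, memo
`CELLSTAR-PENCIL.md` §2b: the strip clash `b₆ = 0`, the box bound), and no transport atlas rescues all of them.

This file proves `CellBridge` at EVERY site, with no new certificate, by TRANSLATION ALONG `𝟙 = (1,…,1)` and a moment argument
(the method of `InvarianceGroup.lean`, ct-1 g15, extended from constant to POLYNOMIAL coefficients):

1. The BRIDGE cluster commutes with `a ↦ a + n·𝟙`, its four coefficients become explicit QUADRATIC polynomials `β_m(n)` (the
   dual coordinates move by `b₀ ↦ b₀ + 3n`, `b_j ↦ b_j + n`), and for all `n ≥ n₀(a)` the four translated members converge and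
   share the rational chamber point `(3n/4, 3n/4)` — so `cellBridge_native` gives `Σ_m β_m(n)·I(x_m + n·𝟙) = 0` for `n ≥ n₀`
   (`bridge_translate`).
2. `n ↦ I(x + n·𝟙)` is a MOMENT SEQUENCE `∫ f·gⁿ`, `0 < g ≤ 1` (`InvarianceGroup.isMoment_cellularIntegral_add`), and so is
   `n ↦ 1/(n+i+1)` (a Beta moment, `MomentSequences.IsMoment.factorialRatio`).  Dividing by `(n+1)(n+2)(n+3)` and expanding each
   `β_m(n)/((n+1)(n+2)(n+3))` in partial fractions (Lagrange interpolation of a quadratic at `−1, −2, −3`) writes the relation as a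
   real LINEAR COMBINATION of twelve moment sequences `I(x_m + n·𝟙)/(n+i+1)` that vanishes for all `n ≥ n₀`.
3. `lincomb_eq_zero_of_eventually`: a real linear combination of moment sequences vanishing for all large `n` vanishes at
   `n = 0` (split the coefficients by sign; sums of moment sequences are moment sequences, `isMoment_add`, by disjoint union of
   the measure spaces; then `IsMoment.eq_zero_of_eventually_eq`).  At `n = 0` this is the BRIDGE relation at `a`.

Main results: **`cellBridge_holds : CellBridge`** (hypothesis-free); the moment lemmas `isMoment_add`, `isMoment_sum`,
`lincomb_eq_zero_of_eventually` (pure measure theory).  Theorems only; no `def`.  What this file is NOT: anything about the three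
level-1 VALUES of `CellStarPencilDischarge.explicitPQ_iff_bridge_data3`, about `explicitPQ` itself, or about irrationality.
-/

noncomputable section

namespace Summit.KontsevichZagierPeriods.Zeta5Search.CellBridgeDischarge

open MeasureTheory Set Filter Finset
open Literature.NumberTheory.Irrationality.BrownZudilin2022
open Summit.KontsevichZagierPeriods.Zeta5Search.WedgeDictionary
open Summit.KontsevichZagierPeriods.Zeta5Search.WedgeDictionary.KernelCells (cellBridge_native chamberQ_intro)
open Summit.KontsevichZagierPeriods.Zeta5Search.WedgeDictionary.Kernel (ChamberQ)
open Summit.KontsevichZagierPeriods.Zeta5Search.MomentSequences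
open Summit.KontsevichZagierPeriods.Zeta5Search.InvarianceGroup (isMoment_cellularIntegral_add)
open Summit.KontsevichZagierPeriods.Zeta5Search.AmpleGroupInvariance (bOfA_add_const shiftB ample_add_const_of_le
  ample_converges)
open Summit.KontsevichZagierPeriods.Zeta5Search.CellularCubicalSubstitution (cellularIntegral_eq_cubicalIntegral_holds)
open Summit.KontsevichZagierPeriods.Zeta5Search.CubicalSubstitution (cubicalIntegral_eq_Jintegral_holds)
open Summit.KontsevichZagierPeriods.Zeta5Search.BarnesDouble (barnes_double_holds)

/-! ## 1. Moment sequences: sums, and linear combinations vanishing for large `n` -/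

/-- **The sum of two moment sequences is a moment sequence** (disjoint union of the two finite measure spaces,
`G` glued by `Sum.elim`; `Sum.inl`/`Sum.inr` are measurable embeddings). [folklore] -/
theorem isMoment_add {m₁ m₂ : ℕ → ℝ} (h₁ : IsMoment m₁) (h₂ : IsMoment m₂) :
    IsMoment (fun n => m₁ n + m₂ n) := by
  obtain ⟨X, _, μ, _, G, hG, hG1, hm₁⟩ := h₁
  obtain ⟨Y, _, ν, _, H, hH, hH1, hm₂⟩ := h₂
  haveI := Measure.isFiniteMeasure_map μ (Sum.inl : X → X ⊕ Y)
  haveI := Measure.isFiniteMeasure_map ν (Sum.inr : Y → X ⊕ Y)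
  -- `Sum.inl`, `Sum.inr` are measurable embeddings (as in `Literature.Analysis.FluidPDE.Tao2016.measurableEmbedding_inl/inr`,
  -- restated locally to keep the imports of this file inside the ζ(5) lineage)
  have measurableEmbedding_inl : MeasurableEmbedding (Sum.inl : X → X ⊕ Y) :=
    ⟨Sum.inl_injective, measurable_inl, fun _ hs => hs.inl_image⟩
  have measurableEmbedding_inr : MeasurableEmbedding (Sum.inr : Y → X ⊕ Y) :=
    ⟨Sum.inr_injective, measurable_inr, fun _ hs => hs.inr_image⟩
  refine ⟨X ⊕ Y, inferInstance, Measure.map Sum.inl μ + Measure.map Sum.inr ν, inferInstance, Sum.elim G H,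
    hG.sumElim hH, ?_, fun n => ?_⟩
  · rintro (x | y)
    · exact hG1 x
    · exact hH1 y
  · have j1 : Integrable (fun x : X => G x ^ n) μ := by simpa using IsMoment.integrable_pow_mul μ hG hG1 n 1 0
    have j2 : Integrable (fun y : Y => H y ^ n) ν := by simpa using IsMoment.integrable_pow_mul ν hH hH1 n 1 0
    have i1 : Integrable (fun z : X ⊕ Y => Sum.elim G H z ^ n) (Measure.map Sum.inl μ) :=
      measurableEmbedding_inl.integrable_map_iff.2 (by simpa [Function.comp_def] using j1)
    have i2 : Integrable (fun z : X ⊕ Y => Sum.elim G H z ^ n) (Measure.map Sum.inr ν) :=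
      measurableEmbedding_inr.integrable_map_iff.2 (by simpa [Function.comp_def] using j2)
    show m₁ n + m₂ n = ∫ z, Sum.elim G H z ^ n ∂(Measure.map Sum.inl μ + Measure.map Sum.inr ν)
    rw [integral_add_measure i1 i2, measurableEmbedding_inl.integral_map, measurableEmbedding_inr.integral_map, hm₁ n, hm₂ n]
    simp only [Sum.elim_inl, Sum.elim_inr]

/-- A non-negative multiple of a moment sequence is a moment sequence. [folklore] -/
theorem isMoment_smul {m : ℕ → ℝ} (h : IsMoment m) {c : ℝ} (hc : 0 ≤ c) : IsMoment (fun n => c * m n) :=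
  (IsMoment.const hc).mul h

/-- A finite sum of moment sequences is a moment sequence. [folklore] -/
theorem isMoment_sum {ι : Type*} (s : Finset ι) (m : ι → ℕ → ℝ) (h : ∀ k ∈ s, IsMoment (m k)) :
    IsMoment (fun n => ∑ k ∈ s, m k n) := by
  classical
  induction s using Finset.induction_on with
  | empty => simpa using IsMoment.const le_rfl
  | insert a s ha ih =>
    have e : (fun n => ∑ k ∈ insert a s, m k n) = fun n => m a n + ∑ k ∈ s, m k n :=
      funext fun n => Finset.sum_insert ha
    rw [e]
    exact isMoment_add (h a (Finset.mem_insert_self a s)) (ih fun k hk => h k (Finset.mem_insert_of_mem hk))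

/-- **A real linear combination of moment sequences that vanishes for all `n ≥ N` vanishes at `n = 0`.**  (Split each
coefficient as `c = max(c,0) − max(−c,0)`: two moment sequences agreeing for `n ≥ N`, hence at `0` by
`IsMoment.eq_zero_of_eventually_eq`.) [folklore] -/
theorem lincomb_eq_zero_of_eventually {ι : Type*} (s : Finset ι) (c : ι → ℝ) (m : ι → ℕ → ℝ)
    (hm : ∀ k ∈ s, IsMoment (m k)) {N : ℕ} (h : ∀ n, N ≤ n → ∑ k ∈ s, c k * m k n = 0) :
    ∑ k ∈ s, c k * m k 0 = 0 := by
  have hL : IsMoment (fun n => ∑ k ∈ s, max (c k) 0 * m k n) :=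
    isMoment_sum s _ fun k hk => isMoment_smul (hm k hk) (le_max_right _ _)
  have hR : IsMoment (fun n => ∑ k ∈ s, max (-c k) 0 * m k n) :=
    isMoment_sum s _ fun k hk => isMoment_smul (hm k hk) (le_max_right _ _)
  have hsplit : ∀ n, ∑ k ∈ s, c k * m k n = (∑ k ∈ s, max (c k) 0 * m k n) - ∑ k ∈ s, max (-c k) 0 * m k n := by
    intro n
    rw [← Finset.sum_sub_distrib]
    refine Finset.sum_congr rfl fun k _ => ?_
    rw [← sub_mul, max_zero_sub_max_neg_zero_eq_self]
  have h0 := IsMoment.eq_zero_of_eventually_eq hL hR (N := N) (fun n hn => sub_eq_zero.1 (by rw [← hsplit]; exact h n hn))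
  rw [hsplit]
  exact sub_eq_zero.2 h0

/-! ## 2. The BRIDGE cluster along the direction `𝟙` -/

/-- `(a + n·𝟙) − s₇ = (a − s₇) + n·𝟙`. -/
theorem translate_sub_slotDown (a : Fin 8 → ℤ) (n : ℕ) :
    (fun i => a i + (n : ℤ)) - slotDown 7 = fun i => (a - slotDown 7) i + (n : ℤ) := by
  funext i; simp only [Pi.sub_apply]; ring

/-- `(a + n·𝟙) + (e₁ + e₃) = (a + e₁ + e₃) + n·𝟙`. -/
theorem translate_add_halfUp457 (a : Fin 8 → ℤ) (n : ℕ) :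
    (fun i => a i + (n : ℤ)) + halfUp457 = fun i => (a + halfUp457) i + (n : ℤ) := by
  funext i; simp only [Pi.add_apply]; ring

/-- `(a + n·𝟙) + DS = (a + DS) + n·𝟙`. -/
theorem translate_add_dsUp (a : Fin 8 → ℤ) (n : ℕ) :
    (fun i => a i + (n : ℤ)) + dsUp = fun i => (a + dsUp) i + (n : ℤ) := by
  funext i; simp only [Pi.add_apply]; ring

/-- The BRIDGE coefficient of the base point along `𝟙`: `d_c(b(a + n·𝟙)) = (b₀+1−b₇+2n)(2b₀−b₁−b₂−b₃−b₆−b₇+n)`. -/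
theorem bridgeBase_translate (a : Fin 8 → ℤ) (n : ℕ) :
    bridgeBase (bOfA (fun i => a i + (n : ℤ))) =
      (bOfA a 0 + 1 - bOfA a 7 + 2 * n) * (2 * bOfA a 0 - bOfA a 1 - bOfA a 2 - bOfA a 3 - bOfA a 6 - bOfA a 7 + n) := by
  rw [bOfA_add_const]; simp [bridgeBase, shiftB]; ring

/-- `d₇(b(a + n·𝟙)) = −(b₀−b₃−b₇+n)(b₀−b₆−b₇+n)`. -/
theorem bridgeSlot_translate (a : Fin 8 → ℤ) (n : ℕ) :
    bridgeSlot (bOfA (fun i => a i + (n : ℤ))) =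
      -((bOfA a 0 - bOfA a 3 - bOfA a 7 + n) * (bOfA a 0 - bOfA a 6 - bOfA a 7 + n)) := by
  rw [bOfA_add_const]; simp [bridgeSlot, shiftB]; ring

/-- `d_X(b(a + n·𝟙)) = (b₀+1−b₇+2n)(b₀+1−b₁−b₆+n)`. -/
theorem bridgeHalf_translate (a : Fin 8 → ℤ) (n : ℕ) :
    bridgeHalf (bOfA (fun i => a i + (n : ℤ))) =
      (bOfA a 0 + 1 - bOfA a 7 + 2 * n) * (bOfA a 0 + 1 - bOfA a 1 - bOfA a 6 + n) := by
  rw [bOfA_add_const]; simp [bridgeHalf, shiftB]; ring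

/-- `d_DS(b(a + n·𝟙)) = (b₁+1+n)(b₆+1+n)`. -/
theorem bridgeApex_translate (a : Fin 8 → ℤ) (n : ℕ) :
    bridgeApex (bOfA (fun i => a i + (n : ℤ))) = (bOfA a 1 + 1 + n) * (bOfA a 6 + 1 + n) := by
  rw [bOfA_add_const]; simp [bridgeApex, shiftB]; ring

/-- Translates far enough along `𝟙` converge (they are even ample: all 28 forms (26) move up by `n`). -/
theorem converges_translate {x : Fin 8 → ℤ} {n : ℕ} (hn : ((hList x).map Int.natAbs).sum ≤ n) :
    Converges (fun i => x i + (n : ℤ)) :=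
  ample_converges (ample_add_const_of_le (by exact_mod_cast hn))

/-- Every coordinate of `a` is bounded in absolute value by `K = Σ_i |a_i|` (cast to `ℚ`). -/
theorem coord_abs_le (a : Fin 8 → ℤ) (i : Fin 8) :
    ((a i : ℤ) : ℚ) ≤ ((∑ j : Fin 8, (a j).natAbs : ℕ) : ℚ) ∧ -((a i : ℤ) : ℚ) ≤ ((∑ j : Fin 8, (a j).natAbs : ℕ) : ℚ) := by
  have h1 : (a i).natAbs ≤ ∑ j : Fin 8, (a j).natAbs :=
    Finset.single_le_sum (f := fun j => (a j).natAbs) (fun j _ => Nat.zero_le _) (Finset.mem_univ i)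
  have hK : (((a i).natAbs : ℕ) : ℚ) ≤ ((∑ j : Fin 8, (a j).natAbs : ℕ) : ℚ) := Nat.cast_le.2 h1
  have h2 : ((a i : ℤ) : ℚ) ≤ (((a i).natAbs : ℕ) : ℚ) := by
    have h := (Int.cast_le (R := ℚ)).2 (Int.le_natAbs (a := a i))
    rwa [Int.cast_natCast] at h
  have h3 : -((a i : ℤ) : ℚ) ≤ (((a i).natAbs : ℕ) : ℚ) := by
    have h0 := Int.le_natAbs (a := -a i)
    rw [Int.natAbs_neg] at h0
    have h := (Int.cast_le (R := ℚ)).2 h0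
    rwa [Int.cast_neg, Int.cast_natCast] at h
  exact ⟨h2.trans hK, h3.trans hK⟩

/-- A rational `ChamberQ` for explicit letter vectors from ten plain inequalities. -/
theorem chamberQ_vec {p0 p1 p2 p3 p4 p5 p6 q1 q2 q3 q4 q5 : ℤ} {c : ℚ} (h1 : 0 < c)
    (h2 : c < 1 + (p0 : ℚ)) (h3 : c < 1 + (p1 : ℚ)) (h4 : c < 1 + (p2 : ℚ)) (h6 : c < 1 + (p4 : ℚ))
    (h7 : c < 1 + (p5 : ℚ)) (h8 : c < 1 + (p6 : ℚ)) (h9 : (1 : ℚ) + p0 + p6 - q3 < c + c) (h10 : c + c < (p3 : ℚ) + 2) :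
    ChamberQ ![p0, p1, p2, p3, p4, p5, p6] ![q1, q2, q3, q4, q5] c c :=
  chamberQ_intro h1 (by simpa using h2) (by simpa using h3) (by simpa using h4) h1 (by simpa using h6)
    (by simpa using h7) (by simpa using h8) (by simpa using h9) (by simpa using h10)

/-- **The BRIDGE relation at the translates `a + n·𝟙`, `n ≥ n₀(a)`**, from gen-1 g22's native certificate
`KernelCells.cellBridge_native` (F1 + F2, tree theorems): for `n ≥ 40·Σ|a_i| + 8` and the four translated members convergent,
the rational point `(3n/4, 3n/4)` lies in the chamber of all four members, so
`d_c·I(a+n𝟙) + d₇·I(a−s₇+n𝟙) + d_X·I(a+e₁+e₃+n𝟙) + d_DS·I(a+DS+n𝟙) = 0` with the coefficients taken at `b(a + n·𝟙)`. -/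
theorem bridge_translate (a : Fin 8 → ℤ) (n : ℕ) (hn : 40 * (∑ j : Fin 8, (a j).natAbs) + 8 ≤ n)
    (hc0 : Converges (fun i => a i + (n : ℤ))) (hc1 : Converges (fun i => (a - slotDown 7) i + (n : ℤ)))
    (hc2 : Converges (fun i => (a + halfUp457) i + (n : ℤ))) (hc3 : Converges (fun i => (a + dsUp) i + (n : ℤ))) :
    ((bridgeBase (bOfA (fun i => a i + (n : ℤ))) : ℤ) : ℝ) * cellularIntegral (fun i => a i + (n : ℤ)) +
      ((bridgeSlot (bOfA (fun i => a i + (n : ℤ))) : ℤ) : ℝ) * cellularIntegral (fun i => (a - slotDown 7) i + (n : ℤ)) +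
      ((bridgeHalf (bOfA (fun i => a i + (n : ℤ))) : ℤ) : ℝ) * cellularIntegral (fun i => (a + halfUp457) i + (n : ℤ)) +
      ((bridgeApex (bOfA (fun i => a i + (n : ℤ))) : ℤ) : ℝ) * cellularIntegral (fun i => (a + dsUp) i + (n : ℤ)) = 0 := by
  obtain ⟨u0, l0⟩ := coord_abs_le a 0
  obtain ⟨u1, l1⟩ := coord_abs_le a 1
  obtain ⟨u2, l2⟩ := coord_abs_le a 2
  obtain ⟨u3, l3⟩ := coord_abs_le a 3
  obtain ⟨u4, l4⟩ := coord_abs_le a 4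
  obtain ⟨u5, l5⟩ := coord_abs_le a 5
  obtain ⟨u6, l6⟩ := coord_abs_le a 6
  obtain ⟨u7, l7⟩ := coord_abs_le a 7
  obtain ⟨K, hK⟩ : ∃ K : ℕ, K = ∑ j : Fin 8, (a j).natAbs := ⟨_, rfl⟩
  rw [← hK] at u0 l0 u1 l1 u2 l2 u3 l3 u4 l4 u5 l5 u6 l6 u7 l7 hn
  have hKn : (40 : ℚ) * K + 8 ≤ n := by exact_mod_cast hn
  have hK0 : (0 : ℚ) ≤ K := by positivity
  set T : Fin 8 → ℤ := fun i => a i + (n : ℤ) with hT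
  -- the letters of the four translated members
  have eP0 : pOf T = ![a 4 + a 5 - a 7 + n, a 1 + a 2 - a 3 + a 5 - a 7 + n, a 5 + n, a 1 + a 2 + a 5 - a 7 + 2 * n,
      a 6 + n, a 2 + a 5 - a 7 + n, a 0 + a 1 - a 3 + a 5 - a 7 + n] := by
    ext j; fin_cases j <;> (simp [pOf, hT]; try ring)
  have eQ0 : qOf T = ![a 3 + n, a 4 + n, a 0 - a 2 + a 4 + n, a 0 + n, a 1 + n] := by
    ext j; fin_cases j <;> (simp [qOf, hT]; try ring)
  have eP1 : pOf (T - slotDown 7) = ![a 4 + a 5 - a 7 + n, a 1 + a 2 - a 3 + a 5 - a 7 + n, a 5 + n,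
      a 1 + a 2 + a 5 - a 7 + 2 * n, a 6 - 1 + n, a 2 + a 5 - a 7 + n, a 0 + a 1 - a 3 + a 5 - a 7 + n] := by
    ext j; fin_cases j <;> simp only [pOf, Pi.sub_apply, hT] <;> simp [slotDown] <;> ring
  have eQ1 : qOf (T - slotDown 7) = ![a 3 + n, a 4 + n, a 0 - a 2 + a 4 + n, a 0 + n, a 1 + n] := by
    ext j; fin_cases j <;> simp only [qOf, Pi.sub_apply, hT] <;> (simp [slotDown]; try ring)
  have eP2 : pOf (T + halfUp457) = ![a 4 + a 5 - a 7 + n, a 1 + a 2 - a 3 + a 5 - a 7 + 1 + n, a 5 + n,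
      a 1 + a 2 + a 5 - a 7 + 1 + 2 * n, a 6 + n, a 2 + a 5 - a 7 + 1 + n, a 0 + a 1 - a 3 + a 5 - a 7 + 1 + n] := by
    ext j; fin_cases j <;> simp only [pOf, Pi.add_apply, hT] <;> simp [halfUp457] <;> ring
  have eQ2 : qOf (T + halfUp457) = ![a 3 + n, a 4 + n, a 0 - a 2 + a 4 + n, a 0 + 1 + n, a 1 + n] := by
    ext j; fin_cases j <;> simp only [qOf, Pi.add_apply, hT] <;> simp [halfUp457] <;> ring
  have eP3 : pOf (T + dsUp) = ![a 4 + a 5 - a 7 + n, a 1 + a 2 - a 3 + a 5 - a 7 + n, a 5 + n,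
      a 1 + a 2 + a 5 - a 7 + 1 + 2 * n, a 6 + n, a 2 + a 5 - a 7 + n, a 0 + a 1 - a 3 + a 5 - a 7 + n] := by
    ext j; fin_cases j <;> simp only [pOf, Pi.add_apply, hT] <;> simp [dsUp] <;> ring
  have eQ3 : qOf (T + dsUp) = ![a 3 + 1 + n, a 4 + n, a 0 - a 2 + a 4 + n, a 0 + n, a 1 + 1 + n] := by
    ext j; fin_cases j <;> simp only [qOf, Pi.add_apply, hT] <;> simp [dsUp] <;> ring
  -- the common chamber point `(3n/4, 3n/4)`
  have hch0 : ChamberQ (pOf T) (qOf T) (3 * n / 4) (3 * n / 4) := by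
    rw [eP0, eQ0]
    refine chamberQ_vec ?_ ?_ ?_ ?_ ?_ ?_ ?_ ?_ ?_ <;> push_cast <;> linarith
  have hch1 : ChamberQ (pOf (T - slotDown 7)) (qOf (T - slotDown 7)) (3 * n / 4) (3 * n / 4) := by
    rw [eP1, eQ1]
    refine chamberQ_vec ?_ ?_ ?_ ?_ ?_ ?_ ?_ ?_ ?_ <;> push_cast <;> linarith
  have hch2 : ChamberQ (pOf (T + halfUp457)) (qOf (T + halfUp457)) (3 * n / 4) (3 * n / 4) := by
    rw [eP2, eQ2]
    refine chamberQ_vec ?_ ?_ ?_ ?_ ?_ ?_ ?_ ?_ ?_ <;> push_cast <;> linarith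
  have hch3 : ChamberQ (pOf (T + dsUp)) (qOf (T + dsUp)) (3 * n / 4) (3 * n / 4) := by
    rw [eP3, eQ3]
    refine chamberQ_vec ?_ ?_ ?_ ?_ ?_ ?_ ?_ ?_ ?_ <;> push_cast <;> linarith
  have hc1' : Converges (T - slotDown 7) := by rw [hT, translate_sub_slotDown]; exact hc1
  have hc2' : Converges (T + halfUp457) := by rw [hT, translate_add_halfUp457]; exact hc2
  have hc3' : Converges (T + dsUp) := by rw [hT, translate_add_dsUp]; exact hc3
  have key := cellBridge_native cellularIntegral_eq_cubicalIntegral_holds cubicalIntegral_eq_Jintegral_holds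
    barnes_double_holds T (3 * n / 4) (3 * n / 4) hc0 hc1' hc2' hc3' hch0 hch1 hch2 hch3
  unfold FourTermRel at key
  rw [hT, translate_sub_slotDown, translate_add_halfUp457, translate_add_dsUp] at key
  push_cast at key ⊢
  exact key

/-! ## 3. `CellBridge` -/

/-- **The cellular BRIDGE family holds** — the `@[conjecture]` node `WedgeDictionary.CellBridge` is a kernel theorem,
hypothesis-free: for every `a` whose four BRIDGE members `a, a − s₇, a + e₁ + e₃, a + DS` satisfy the hypotheses of `explicitPQ`,
`d_c·I(a) + d₇·I(a − s₇) + d_X·I(a + e₁ + e₃) + d_DS·I(a + DS) = 0` with gen-1 g15's closed-form coefficients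
`d_c = (N+1−c₇)(2N−c₁−c₂−c₃−c₆−c₇)`, `d₇ = −(N−c₃−c₇)(N−c₆−c₇)`, `d_X = (N+1−c₇)(N+1−c₁−c₆)`, `d_DS = (c₁+1)(c₆+1)` at `c = b(a)`.
Proof: `bridge_translate` for all `n ≥ n₀(a)`, division by `(n+1)(n+2)(n+3)`, and `lincomb_eq_zero_of_eventually` applied to the
twelve moment sequences `I(x_m + n·𝟙)/(n+i+1)`. -/
theorem cellBridge_holds : CellBridge := by
  intro a j₀ j₁ j₂ j₃ r₀ r₁ r₂ r₃
  -- the four moment sequences `n ↦ I(x_m + n·𝟙)` and the three Beta moments `n ↦ 1/(n+i+1)`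
  set M : Fin 4 → ℕ → ℝ := ![fun n => cellularIntegral (fun i => a i + (n : ℤ)),
    fun n => cellularIntegral (fun i => (a - slotDown 7) i + (n : ℤ)),
    fun n => cellularIntegral (fun i => (a + halfUp457) i + (n : ℤ)),
    fun n => cellularIntegral (fun i => (a + dsUp) i + (n : ℤ))] with hM
  have hM0 : IsMoment (M 0) := by simpa [hM] using isMoment_cellularIntegral_add r₀.2.1
  have hM1 : IsMoment (M 1) := by simpa [hM] using isMoment_cellularIntegral_add r₁.2.1
  have hM2 : IsMoment (M 2) := by simpa [hM] using isMoment_cellularIntegral_add r₂.2.1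
  have hM3 : IsMoment (M 3) := by simpa [hM] using isMoment_cellularIntegral_add r₃.2.1
  have hMall : ∀ k : Fin 4, IsMoment (M k) := by
    intro k; fin_cases k
    · exact hM0
    · exact hM1
    · exact hM2
    · exact hM3
  set u : Fin 3 → ℕ → ℝ := fun i n => ((n + (i : ℕ)).factorial : ℝ) / (n + ((i : ℕ) + 1)).factorial with hu
  have huM : ∀ i : Fin 3, IsMoment (u i) := fun i => IsMoment.factorialRatio (by omega)
  have hu_eq : ∀ (i : Fin 3) (n : ℕ), u i n = 1 / ((n : ℝ) + (i : ℕ) + 1) := by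
    intro i n
    simp only [hu]
    rw [show n + ((i : ℕ) + 1) = (n + (i : ℕ)) + 1 by ring, Nat.factorial_succ]
    have hf : ((n + (i : ℕ)).factorial : ℝ) ≠ 0 := by positivity
    push_cast
    field_simp
  -- the four quadratic coefficient polynomials along `𝟙` (real variable)
  set β : Fin 4 → ℝ → ℝ := ![
    fun t => ((bOfA a 0 : ℝ) + 1 - bOfA a 7 + 2 * t) * (2 * (bOfA a 0 : ℝ) - bOfA a 1 - bOfA a 2 - bOfA a 3 - bOfA a 6 - bOfA a 7 + t),
    fun t => -(((bOfA a 0 : ℝ) - bOfA a 3 - bOfA a 7 + t) * ((bOfA a 0 : ℝ) - bOfA a 6 - bOfA a 7 + t)),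
    fun t => ((bOfA a 0 : ℝ) + 1 - bOfA a 7 + 2 * t) * ((bOfA a 0 : ℝ) + 1 - bOfA a 1 - bOfA a 6 + t),
    fun t => ((bOfA a 1 : ℝ) + 1 + t) * ((bOfA a 6 : ℝ) + 1 + t)] with hβ
  -- Lagrange weights at the nodes `-1, -2, -3` for the denominator `(n+1)(n+2)(n+3)`
  set L : Fin 3 → ℝ := ![1 / 2, -1, 1 / 2] with hL
  -- the twelve-term linear combination
  set c : Fin 4 × Fin 3 → ℝ := fun ki => β ki.1 (-((ki.2 : ℕ) + 1 : ℝ)) * L ki.2 with hc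
  set m : Fin 4 × Fin 3 → ℕ → ℝ := fun ki n => u ki.2 n * M ki.1 n with hm
  have hm_moment : ∀ ki ∈ (Finset.univ : Finset (Fin 4 × Fin 3)), IsMoment (m ki) :=
    fun ki _ => (huM ki.2).mul (hMall ki.1)
  -- KEY IDENTITY: the combination is the BRIDGE expression divided by `(n+1)(n+2)(n+3)` (partial fractions, per member)
  have key1 : ∀ (k : Fin 4) (n : ℕ),
      ∑ i : Fin 3, c (k, i) * u i n = β k n / (((n : ℝ) + 1) * ((n : ℝ) + 2) * ((n : ℝ) + 3)) := by
    intro k n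
    have h1 : ((n : ℝ) + 1) ≠ 0 := by positivity
    have h2 : ((n : ℝ) + 2) ≠ 0 := by positivity
    have h3 : ((n : ℝ) + 3) ≠ 0 := by positivity
    have h1' : ((n : ℝ) + 0 + 1) ≠ 0 := by positivity
    have h2' : ((n : ℝ) + 1 + 1) ≠ 0 := by positivity
    have h3' : ((n : ℝ) + 2 + 1) ≠ 0 := by positivity
    simp only [Fin.sum_univ_three, hc, hu_eq, hL, Matrix.cons_val, Fin.isValue, Fin.val_zero, Fin.val_one, Fin.val_two,
      Nat.cast_zero, Nat.cast_one, Nat.cast_ofNat]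
    fin_cases k <;> simp only [Fin.reduceFinMk, hβ, Matrix.cons_val] <;> field_simp <;> ring
  have key : ∀ n : ℕ, ∑ ki, c ki * m ki n =
      (∑ k, β k n * M k n) / (((n : ℝ) + 1) * ((n : ℝ) + 2) * ((n : ℝ) + 3)) := by
    intro n
    rw [Fintype.sum_prod_type, Finset.sum_div]
    refine Finset.sum_congr rfl fun k _ => ?_
    have hk : ∑ i : Fin 3, c (k, i) * m (k, i) n = (∑ i : Fin 3, c (k, i) * u i n) * M k n := by
      rw [Finset.sum_mul]
      refine Finset.sum_congr rfl fun i _ => ?_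
      simp only [hm]
      ring
    rw [hk, key1 k n]
    ring
  -- the BRIDGE expression vanishes at all large translates
  obtain ⟨N₀, hN₀⟩ : ∃ N₀ : ℕ, N₀ = 40 * (∑ j : Fin 8, (a j).natAbs) + 8 + ((hList a).map Int.natAbs).sum +
    ((hList (a - slotDown 7)).map Int.natAbs).sum + ((hList (a + halfUp457)).map Int.natAbs).sum +
    ((hList (a + dsUp)).map Int.natAbs).sum := ⟨_, rfl⟩
  have hnum : ∀ n : ℕ, N₀ ≤ n → ∑ k, β k n * M k n = 0 := by
    intro n hn
    have h := bridge_translate a n (by omega) (converges_translate (by omega)) (converges_translate (by omega))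
      (converges_translate (by omega)) (converges_translate (by omega))
    rw [bridgeBase_translate, bridgeSlot_translate, bridgeHalf_translate, bridgeApex_translate] at h
    push_cast at h
    simp only [Fin.sum_univ_four, hβ, hM, Matrix.cons_val]
    linear_combination h
  have hzero : ∀ n : ℕ, N₀ ≤ n → ∑ ki, c ki * m ki n = 0 := by
    intro n hn
    rw [key n, hnum n hn, zero_div]
  -- hence it vanishes at `n = 0`
  have h0 := lincomb_eq_zero_of_eventually Finset.univ c m hm_moment hzero
  rw [key 0, div_eq_zero_iff] at h0
  have hden : (((0 : ℕ) : ℝ) + 1) * (((0 : ℕ) : ℝ) + 2) * (((0 : ℕ) : ℝ) + 3) ≠ 0 := by norm_num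
  have h00 : ∑ k, β k ((0 : ℕ) : ℝ) * M k 0 = 0 := h0.resolve_right hden
  have e0 : (fun i => a i + ((0 : ℕ) : ℤ)) = a := funext fun i => by simp
  have e1 : (fun i => (a - slotDown 7) i + ((0 : ℕ) : ℤ)) = a - slotDown 7 := funext fun i => by simp
  have e2 : (fun i => (a + halfUp457) i + ((0 : ℕ) : ℤ)) = a + halfUp457 := funext fun i => by simp
  have e3 : (fun i => (a + dsUp) i + ((0 : ℕ) : ℤ)) = a + dsUp := funext fun i => by simp
  simp only [Fin.sum_univ_four, hβ, hM, Matrix.cons_val] at h00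
  simp only [e0, e1, e2, e3] at h00
  simp only [Nat.cast_zero] at h00
  unfold FourTermRel
  simp only [bridgeBase, bridgeSlot, bridgeHalf, bridgeApex]
  push_cast
  linear_combination h00

end Summit.KontsevichZagierPeriods.Zeta5Search.CellBridgeDischarge

end
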